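import Mathlib
import Summits.AtomisticToContinuum.Crystallization.Theorems.ReggeStarCoercivityDefectFreeCrystallizesChargeFromFunnelLaw
import Summits.AtomisticToContinuum.Crystallization.Theorems.ReggeStarCoercivityDefectFreeCrystallizesGoodLaw
import Summits.AtomisticToContinuum.Crystallization.Theorems.PalmUnimodularRigidityLayeredLawsSelectHcpUniqueMinimiser
import Summits.AtomisticToContinuum.Crystallization.Theorems.PalmUnimodularRigidityLayeredLawsSelectHcpMinimiserEnclosure
import Summits.AtomisticToContinuum.Crystallization.Theorems.PalmUnimodularRigidityLayeredLawsSelectHcpRelaxedReference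
import Summits.AtomisticToContinuum.Crystallization.Theorems.SquareWellLayerCakeTwelveWithinOne
import Summits.AtomisticToContinuum.Crystallization.Theorems.PalmUnimodularRigidityBenjaminiSchrammLimit
import Summits.AtomisticToContinuum.Crystallization.Theorems.ChessboardParticlePlanesLjLaminarWindowsOneWindowAllScales
import HarnessLib

/-!
# Laminar windows from the law-level rigidity of the good limit law — line `stacking-blind-budget-flatness`
(law-level form), crux `ChessboardParticlePlanes.LjLaminarWindows` (stmt-AtomisticToContinuum-6711), lead a1

The all-scales one-window laminarity residual S9♭ of the crux (`LjLaminarWindowsSketch.LjLaminarWindows_of_oneWindowAllScales`,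
p137588, turns it into the crux) follows from three statements of the hcp programme, two of them LANDED:

* P1 `PalmGoodLaw.stub_goodLaw : GoodLawOfZeroDefects` (LANDED): a zero-defect Lennard-Jones ground-state sequence has a good
  Benjamini–Schramm limit law (hard core, point-stationary, energy identity, DENSITY TRANSFER, a.s. everywhere `SetGood`);
* FUNNEL LAW RIGIDITY (the second hypothesis of the LANDED R3 `PalmGoodLaw.ChargeFromFunnelLaw.stub_chargeFromFunnelLaw`,
  verbatim; it is the sorry-free consequence `funnelLawRigidity_of_stubs` of crux 13603's registered CORE `stub_funnelDefectFloor`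
  and its landed X2/X3 in that crux's skeleton `Lines/exact_star_shortcut.lean`): a minimising point-stationary hard-core law a.s.
  carried by everywhere-`SetGood` configurations is a.s. `count|A(hcpStacking a h)` with `e(hcp a h) = e*`;
* the zero-defect hypothesis along every ground-state sequence (= item 13604 `ZeroDefectDensity`).

`oneWindowAllScales_of_funnelLawRigidity` proves P1 → FunnelLawRigidity → (zero defects along every sequence) → S9♭:
the good limit law is minimising (`CrysEnergyLimit_holds`), so a.s. an exact rotated hcp crystal with OPTIMAL parameters; optimal
parameters are global minimisers of `hcpE` ("pinning is free", `hcpE_globalMin_of_energy_eq_eStar`), hence equal to the relaxed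
reference `(a₀, h₀)` (`stub_relaxedReference` + `tube_hcpE_unique_minimiser`) with `|h₀ − 0.79294| ≤ 10⁻⁴`
(`tube_minimiserEnclosure`) — so the law charges ONE configuration `hcpStacking a₀ h₀` with probability one; the density-transfer
clause of P1 (with `matched_hcp_of_matched_near` at `η = 0`) gives, eventually along the extraction, a particle whose closed
`L`-ball is `η`-matched INTO `x i + A(hcpStacking a₀ h₀)`; read through `A⁻¹`, every particle of that ball is within `η`, in the
third coordinate, of the height set `h₀ℤ`, which is `h₀ ≥ 0.7928 > 3/4`-separated.  This is the law-level form of the line's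
mechanism (budget `E_P[h] ≤ e*` ÷ the programme's coercivity ⇒ exact pinned scale `h₀` ⇒ laminar windows), card reshape option (3).
-/

noncomputable section

open scoped ENNReal
open Filter Topology MeasureTheory Set

namespace Summit.AtomisticToContinuum.Crystallization.Theorems.StackingBlindBudgetFlatness

open Summit.AtomisticToContinuum.Crystallization.Theses
open Summit.AtomisticToContinuum.Crystallization.Theorems.PalmUnimodularRigidity
open Summit.AtomisticToContinuum.Crystallization.Theorems.PalmUnimodularRigidity.LayeredLawsSelectHcp
  (hcpE stub_relaxedReference tube_hcpE_unique_minimiser tube_minimiserEnclosure)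
open Summit.AtomisticToContinuum.Crystallization.Theorems.SquareWellLayerCakeTwelveWithinOne.Closing
  (hcpE_globalMin_of_energy_eq_eStar)
open Summit.AtomisticToContinuum.Crystallization.Theorems.PalmGoodLaw
open Literature.MathematicalPhysics.StatisticalMechanics Literature.Geometry.DiscreteGeometry
open Literature.Probability.Process

/-- **A window matched into a rotated hcp crystal is laminar**: if every particle of the closed `L`-ball of `x i` is within `η`
of `x i + A s` for some `s ∈ hcpStacking a h` (`h ≥ 3/4`), then, read through `A⁻¹`, every such particle is within `η` in the
third coordinate of the `3/4`-separated height set `hℤ`. -/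
theorem laminar_of_matched_hcp {N : ℕ} {x : Fin N → EuclideanSpace ℝ (Fin 3)} {i : Fin N} {a h L η : ℝ}
    (hh : (3 : ℝ) / 4 ≤ h) (A : EuclideanSpace ℝ (Fin 3) ≃ₗᵢ[ℝ] EuclideanSpace ℝ (Fin 3))
    (hmatch : ∀ j : Fin N, dist (x j) (x i) ≤ L →
      ∃ s ∈ hcpStacking a h, dist (x j) (x i + A.toLinearIsometry (s - 0)) ≤ η) :
    ∃ (A' : EuclideanSpace ℝ (Fin 3) →ₗᵢ[ℝ] EuclideanSpace ℝ (Fin 3)) (T : Set ℝ),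
      (∀ t ∈ T, ∀ t' ∈ T, t ≠ t' → (3 : ℝ) / 4 ≤ |t - t'|) ∧
      (∀ j : Fin N, dist (x j) (x i) ≤ L → ∃ t ∈ T, |(A' (x j - x i)) 2 - t| ≤ η) := by
  refine ⟨A.symm.toLinearIsometry, Set.range fun k : ℤ => (k : ℝ) * h, ?_, ?_⟩
  · rintro _ ⟨k, rfl⟩ _ ⟨k', rfl⟩ hne
    have hkk' : k ≠ k' := fun e => hne (by rw [e])
    have h1 : (1 : ℝ) ≤ |(k : ℝ) - k'| := by
      rw [← Int.cast_sub, ← Int.cast_abs]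
      exact_mod_cast Int.one_le_abs (sub_ne_zero.2 hkk')
    rw [← sub_mul, abs_mul, abs_of_nonneg (by linarith : (0 : ℝ) ≤ h)]
    nlinarith
  · intro j hj
    obtain ⟨s, ⟨k, m, n, rfl⟩, hd⟩ := hmatch j hj
    refine ⟨(k : ℝ) * h, ⟨k, rfl⟩, ?_⟩
    have e1 : dist (x j) (x i + A.toLinearIsometry (barlowPos a h alternatingHagg k m n - 0)) =
        ‖A.symm (x j - x i) - barlowPos a h alternatingHagg k m n‖ := by
      rw [sub_zero, LinearIsometryEquiv.coe_toLinearIsometry, dist_eq_norm, ← LinearIsometryEquiv.norm_map A.symm,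
        map_sub, map_add, LinearIsometryEquiv.symm_apply_apply, map_sub]
      congr 1
      abel
    rw [e1] at hd
    have e2 : (A.symm.toLinearIsometry (x j - x i)) 2 - (k : ℝ) * h =
        (A.symm (x j - x i)) 2 - (barlowPos a h alternatingHagg k m n) 2 := by
      rw [LinearIsometryEquiv.coe_toLinearIsometry, barlowPos_apply_two]
    rw [e2, ← Real.dist_eq]
    exact (PiLp.dist_apply_le _ _ 2).trans (by rwa [dist_eq_norm])

/-- **Core transfer lemma: a law a.s. charging ONE optimal rotated hcp crystal family gives laminar windows frequently.**
Given an extraction `φ`, a probability law `P` on configurations with the DENSITY-TRANSFER clause of the Benjamini–Schramm limit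
for the sequence `x` along `φ`, and `P`-a.s. `μ = count|A(hcpStacking a h)` with `e(hcp a h) = e*`, every thickness `η > 0` and
every radius `L` admit, frequently in `N`, a particle with an `η`-laminar closed `L`-window and `3/4`-separated heights.  (Optimal
parameters equal the relaxed reference, `h₀ ≥ 0.7928`; `P`-almost all of `P` sits on that ONE crystal family, so the transfer
clause applies with `ρ = 1/2`; `matched_hcp_of_matched_near` at `η = 0`; `laminar_of_matched_hcp`.) -/
theorem frequently_laminarWindow_of_hcpLaw (x : (N : ℕ) → (Fin N → EuclideanSpace ℝ (Fin 3)))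
    {φ : ℕ → ℕ} (hφ : StrictMono φ) (P : Measure (Measure (EuclideanSpace ℝ (Fin 3)))) [IsProbabilityMeasure P]
    (htr : ∀ T : Set (Measure (EuclideanSpace ℝ (Fin 3))), ∀ R ε : ℝ, 0 < ε → ∀ ρ : ℝ, ρ < (P T).toReal →
      ∀ᶠ j : ℕ in atTop,
        ρ * (φ j : ℝ) ≤ (Nat.card {i : Fin (φ j) // ∃ ν ∈ T,
          ((∀ p : EuclideanSpace ℝ (Fin 3), ν {p} ≠ 0 → ‖p‖ ≤ R →
              ∃ q ∈ (Set.range (fun k : Fin (φ j) => x (φ j) k - x (φ j) i)), dist q p ≤ ε) ∧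
           (∀ q ∈ (Set.range (fun k : Fin (φ j) => x (φ j) k - x (φ j) i)), ‖q‖ ≤ R →
              ∃ p : EuclideanSpace ℝ (Fin 3), ν {p} ≠ 0 ∧ dist q p ≤ ε))} : ℝ))
    (hae : ∀ᵐ μ ∂P, ∃ a h : ℝ, ∃ ha : a ≠ 0, ∃ hh : h ≠ 0, 1 / 2 ≤ a ∧ a ≤ 2 ∧ 1 / 2 ≤ h ∧ h ≤ 2 ∧
        ∃ A : EuclideanSpace ℝ (Fin 3) ≃ₗᵢ[ℝ] EuclideanSpace ℝ (Fin 3),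
          (hcpPeriodicConfiguration ha hh).energyPerParticle lennardJones =
            (⨅ Q : PeriodicConfiguration 3, Q.energyPerParticle lennardJones) ∧
          μ = (Measure.count : Measure (EuclideanSpace ℝ (Fin 3))).restrict (A '' hcpStacking a h))
    {η : ℝ} (hη : 0 < η) (L : ℝ) :
    ∃ᶠ N in Filter.atTop,
      ∃ (i : Fin N) (A : EuclideanSpace ℝ (Fin 3) →ₗᵢ[ℝ] EuclideanSpace ℝ (Fin 3)) (T : Set ℝ),
        (∀ t ∈ T, ∀ t' ∈ T, t ≠ t' → (3 : ℝ) / 4 ≤ |t - t'|) ∧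
        (∀ j : Fin N, dist (x N j) (x N i) ≤ L → ∃ t ∈ T, |(A (x N j - x N i)) 2 - t| ≤ η) := by
  -- optimal parameters are the relaxed reference
  obtain ⟨a₀, h₀, ha₁, ha₂, hh₁, hh₂, hmin₀⟩ := stub_relaxedReference
  have ha₀ : 0 < a₀ := by linarith
  have hh₀ : 0 < h₀ := by linarith
  have henc := tube_minimiserEnclosure a₀ h₀ ha₁ ha₂ hh₁ hh₂ hmin₀
  have hh₀34 : (3 : ℝ) / 4 ≤ h₀ := by
    have := (abs_le.1 henc.2).1
    linarith
  set T : Set (Measure (EuclideanSpace ℝ (Fin 3))) :=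
    {μ | ∃ A : EuclideanSpace ℝ (Fin 3) ≃ₗᵢ[ℝ] EuclideanSpace ℝ (Fin 3),
      μ = (Measure.count : Measure (EuclideanSpace ℝ (Fin 3))).restrict (A '' hcpStacking a₀ h₀)} with hTdef
  have haeT : ∀ᵐ μ ∂P, μ ∈ T := by
    filter_upwards [hae] with μ hμ
    obtain ⟨a, h, ha, hh, ha1, -, hh1, -, A, hopt, rfl⟩ := hμ
    have hapos : 0 < a := by linarith
    have hhpos : 0 < h := by linarith
    have hmin := hcpE_globalMin_of_energy_eq_eStar ha hh hopt
    have heq : hcpE a h = hcpE a₀ h₀ := le_antisymm (hmin a₀ h₀ ha₀ hh₀) (hmin₀ a h hapos hhpos)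
    obtain ⟨rfl, rfl⟩ := tube_hcpE_unique_minimiser a₀ h₀ a h ha₀ hh₀ hapos hhpos hmin₀ heq
    exact ⟨A, rfl⟩
  -- `P T = 1`
  have hPT : (1 : ℝ) / 2 < (P T).toReal := by
    have hc : P Tᶜ = 0 := by
      have := ae_iff.1 haeT
      simpa [Set.compl_def] using this
    have h1 : P Set.univ ≤ P T + P Tᶜ := by
      rw [← Set.union_compl_self T]
      exact measure_union_le T Tᶜ
    rw [measure_univ, hc, add_zero] at h1
    have hT1 : P T = 1 := le_antisymm prob_le_one h1
    rw [hT1, ENNReal.toReal_one]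
    norm_num
  -- density transfer at scale `(R + η, η/2)`, `R := max L 0`
  set R : ℝ := max L 0 with hRdef
  have hev := htr T (R + η) (η / 2) (half_pos hη) (1 / 2) hPT
  set good : (N : ℕ) → Fin N → Prop := fun N i =>
    ∃ A : EuclideanSpace ℝ (Fin 3) ≃ₗᵢ[ℝ] EuclideanSpace ℝ (Fin 3),
      ∀ j : Fin N, dist (x N j) (x N i) ≤ R →
        ∃ s ∈ hcpStacking a₀ h₀, dist (x N j) (x N i + A.toLinearIsometry (s - 0)) ≤ η
    with hgood_def
  have himp : ∀ (N : ℕ) (i : Fin N),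
      (∃ ν ∈ T, ((∀ p : EuclideanSpace ℝ (Fin 3), ν {p} ≠ 0 → ‖p‖ ≤ R + η →
          ∃ q ∈ (Set.range (fun k : Fin N => x N k - x N i)), dist q p ≤ η / 2) ∧
        (∀ q ∈ (Set.range (fun k : Fin N => x N k - x N i)), ‖q‖ ≤ R + η →
          ∃ p : EuclideanSpace ℝ (Fin 3), ν {p} ≠ 0 ∧ dist q p ≤ η / 2))) → good N i := by
    rintro N i ⟨ν, ⟨A, rfl⟩, h1, h2⟩
    have h1' : ∀ p : EuclideanSpace ℝ (Fin 3), p ∈ A '' hcpStacking a₀ h₀ → ‖p‖ ≤ R + η →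
        ∃ q ∈ Set.range (fun k : Fin N => x N k - x N i), dist q p ≤ η / 2 := fun p hp =>
      h1 p ((count_restrict_singleton_ne_zero_iff _ p).2 hp)
    have h2' : ∀ q ∈ Set.range (fun k : Fin N => x N k - x N i), ‖q‖ ≤ R + η →
        ∃ p : EuclideanSpace ℝ (Fin 3), p ∈ A '' hcpStacking a₀ h₀ ∧ dist q p ≤ η / 2 :=
      fun q hq hqn => (h2 q hq hqn).imp fun p hp =>
        ⟨(count_restrict_singleton_ne_zero_iff _ p).1 hp.1, hp.2⟩
    have ha12 : (1 : ℝ) / 2 ≤ a₀ := by linarith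
    have hh12 : (1 : ℝ) / 2 ≤ h₀ := by linarith
    obtain ⟨-, c2⟩ := matched_hcp_of_matched_near ha12 hh12 ha12 hh12 le_rfl
      (by rw [sub_self, abs_zero]) (by rw [sub_self, abs_zero]) hη.le
      (by rw [mul_zero, zero_mul]; exact hη.le) A (x N) i h1' h2'
    exact ⟨A, c2⟩
  have hev' : ∀ᶠ j : ℕ in atTop, ∃ i : Fin (φ j), good (φ j) i := by
    have hj1 : ∀ᶠ j : ℕ in atTop, 1 ≤ φ j := hφ.tendsto_atTop.eventually_ge_atTop 1
    filter_upwards [hev, hj1] with j hj hj1'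
    have hcard : (1 : ℝ) / 2 * ((φ j : ℕ) : ℝ) ≤ (Nat.card {i : Fin (φ j) // good (φ j) i} : ℝ) := by
      refine hj.trans ?_
      exact_mod_cast Nat.card_le_card_of_injective _
        (Subtype.map_injective (fun i hi => himp (φ j) i hi) Function.injective_id)
    have hpos : (0 : ℝ) < (Nat.card {i : Fin (φ j) // good (φ j) i} : ℝ) := by
      have : (1 : ℝ) ≤ ((φ j : ℕ) : ℝ) := by exact_mod_cast hj1'
      linarith
    have hne : Nonempty {i : Fin (φ j) // good (φ j) i} := by
      by_contra hemp
      rw [not_nonempty_iff] at hemp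
      simp at hpos
    obtain ⟨⟨i, hi⟩⟩ := hne
    exact ⟨i, hi⟩
  -- a good particle carries a laminar `L`-window
  have hwin : ∀ᶠ j : ℕ in atTop, ∃ (i : Fin (φ j)) (A : EuclideanSpace ℝ (Fin 3) →ₗᵢ[ℝ] EuclideanSpace ℝ (Fin 3)) (T : Set ℝ),
      (∀ t ∈ T, ∀ t' ∈ T, t ≠ t' → (3 : ℝ) / 4 ≤ |t - t'|) ∧
      (∀ j' : Fin (φ j), dist (x (φ j) j') (x (φ j) i) ≤ L → ∃ t ∈ T, |(A (x (φ j) j' - x (φ j) i)) 2 - t| ≤ η) := by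
    filter_upwards [hev'] with j hj
    obtain ⟨i, A, hA⟩ := hj
    have hA' : ∀ j' : Fin (φ j), dist (x (φ j) j') (x (φ j) i) ≤ L →
        ∃ s ∈ hcpStacking a₀ h₀, dist (x (φ j) j') (x (φ j) i + A.toLinearIsometry (s - 0)) ≤ η :=
      fun j' hj' => hA j' (hj'.trans (le_max_left _ _))
    obtain ⟨A', T', hT', hlam⟩ := laminar_of_matched_hcp hh₀34 A hA'
    exact ⟨i, A', T', hT', hlam⟩
  exact hφ.tendsto_atTop.frequently
    (p := fun N : ℕ => ∃ (i : Fin N) (A : EuclideanSpace ℝ (Fin 3) →ₗᵢ[ℝ] EuclideanSpace ℝ (Fin 3)) (T : Set ℝ),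
      (∀ t ∈ T, ∀ t' ∈ T, t ≠ t' → (3 : ℝ) / 4 ≤ |t - t'|) ∧
      (∀ j : Fin N, dist (x N j) (x N i) ≤ L → ∃ t ∈ T, |(A (x N j - x N i)) 2 - t| ≤ η))
    hwin.frequently

/-- **S9♭ FROM FUNNEL LAW RIGIDITY (zero-defect sequences).** `GoodLawOfZeroDefects` (P1, landed as `PalmGoodLaw.stub_goodLaw`) →
FUNNEL LAW RIGIDITY (verbatim the hypothesis of the landed `stub_chargeFromFunnelLaw`; ⇐ crux 13603's registered CORE
`stub_funnelDefectFloor` by that crux's sorry-free glue `funnelLawRigidity_of_stubs` over its landed X2/X3) → (zero defects along every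
Lennard-Jones ground-state sequence, item 13604 `ZeroDefectDensity`) → for every ground-state sequence, every thickness `η > 0` and EVERY
radius `L`, frequently in `N`, some particle carries an `η`-laminar closed `L`-window with `3/4`-separated heights (S9♭). -/
theorem oneWindowAllScales_of_funnelLawRigidity
    (hG : GoodLawOfZeroDefects)
    (hFR : ∀ δ : ℝ, 0 < δ → ∀ P : Measure (Measure (EuclideanSpace ℝ (Fin 3))), IsProbabilityMeasure P →
      (∀ᵐ μ ∂P, IsRootedHardCore δ μ) → IsPointStationaryLaw P →
      (∫ μ, (∫ y, lennardJones ‖y‖ ∂μ) / 2 ∂P) ≤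
        (⨅ Q : PeriodicConfiguration 3, Q.energyPerParticle lennardJones) →
      (∀ᵐ μ ∂P, ∃ S : Set (EuclideanSpace ℝ (Fin 3)),
        μ = (Measure.count : Measure (EuclideanSpace ℝ (Fin 3))).restrict S ∧ ∀ y ∈ S, SetGood S y) →
      ∀ᵐ μ ∂P, ∃ a h : ℝ, ∃ ha : a ≠ 0, ∃ hh : h ≠ 0, 1 / 2 ≤ a ∧ a ≤ 2 ∧ 1 / 2 ≤ h ∧ h ≤ 2 ∧
        ∃ A : EuclideanSpace ℝ (Fin 3) ≃ₗᵢ[ℝ] EuclideanSpace ℝ (Fin 3),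
          (hcpPeriodicConfiguration ha hh).energyPerParticle lennardJones =
            (⨅ Q : PeriodicConfiguration 3, Q.energyPerParticle lennardJones) ∧
          μ = (Measure.count : Measure (EuclideanSpace ℝ (Fin 3))).restrict (A '' hcpStacking a h))
    (hZ : ∀ x : (N : ℕ) → (Fin N → EuclideanSpace ℝ (Fin 3)), (∀ N, IsGroundState lennardJones (x N)) →
      ZeroDefectsAlong x) :
    ∀ x : (N : ℕ) → (Fin N → EuclideanSpace ℝ (Fin 3)),
      (∀ N, IsGroundState lennardJones (x N)) →
      ∀ η : ℝ, 0 < η → ∀ L : ℝ, ∃ᶠ N in Filter.atTop,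
        ∃ (i : Fin N) (A : EuclideanSpace ℝ (Fin 3) →ₗᵢ[ℝ] EuclideanSpace ℝ (Fin 3)) (T : Set ℝ),
          (∀ t ∈ T, ∀ t' ∈ T, t ≠ t' → (3 : ℝ) / 4 ≤ |t - t'|) ∧
          (∀ j : Fin N, dist (x N j) (x N i) ≤ L → ∃ t ∈ T, |(A (x N j - x N i)) 2 - t| ≤ η) := by
  intro x hx η hη L
  obtain ⟨φ, δ, P, hφ, hδ, hP, hcore, hstat, hE, htr, hgood⟩ := hG x hx (hZ x hx)
  -- the good limit law is minimising
  have hLim : PalmUnimodularRigidity.CrysEnergyLimit := PalmUnimodularRigidity.CrysEnergyLimit_holds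
  have hlim' : Tendsto (fun j : ℕ => groundStateEnergy lennardJones 3 (φ j) / (φ j : ℝ)) atTop
      (𝓝 (⨅ Q : PeriodicConfiguration 3, Q.energyPerParticle lennardJones)) :=
    hLim.comp hφ.tendsto_atTop
  have hEq := tendsto_nhds_unique hE hlim'
  -- funnel law rigidity, then the core transfer lemma
  exact frequently_laminarWindow_of_hcpLaw x hφ P htr (hFR δ hδ P hP hcore hstat hEq.le hgood) hη L

/-- **S9♭ FROM PALM RIGIDITY (all sequences; route PalmUnimodularRigidity's target).** `PalmUnimodularRigidity.PalmRigidity`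
(⇐ cruxes 9225 `MinimiserShells` and 9226 `LayeredLawsSelectHcp` by the landed glue `cruxesToPalmRigidity_proof` over the landed
`ShellsToBarlowChart_of`) gives S9♭ for EVERY Lennard-Jones ground-state sequence, through the PROVED Benjamini–Schramm limit (item 9230,
`benjaminiSchrammLimit_proof`) and `CrysEnergyLimit_holds` — no zero-defect hypothesis. -/
theorem oneWindowAllScales_of_palmRigidity (hPR : PalmUnimodularRigidity.PalmRigidity) :
    ∀ x : (N : ℕ) → (Fin N → EuclideanSpace ℝ (Fin 3)),
      (∀ N, IsGroundState lennardJones (x N)) →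
      ∀ η : ℝ, 0 < η → ∀ L : ℝ, ∃ᶠ N in Filter.atTop,
        ∃ (i : Fin N) (A : EuclideanSpace ℝ (Fin 3) →ₗᵢ[ℝ] EuclideanSpace ℝ (Fin 3)) (T : Set ℝ),
          (∀ t ∈ T, ∀ t' ∈ T, t ≠ t' → (3 : ℝ) / 4 ≤ |t - t'|) ∧
          (∀ j : Fin N, dist (x N j) (x N i) ≤ L → ∃ t ∈ T, |(A (x N j - x N i)) 2 - t| ≤ η) := by
  intro x hx η hη L
  obtain ⟨φ, hφ, δ, hδ, P, hP, hcore, hmecke, hE, htr⟩ :=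
    Summit.AtomisticToContinuum.Crystallization.Theorems.benjaminiSchrammLimit_proof x hx
  have hLim : PalmUnimodularRigidity.CrysEnergyLimit := PalmUnimodularRigidity.CrysEnergyLimit_holds
  have hlim' : Tendsto (fun j : ℕ => groundStateEnergy lennardJones 3 (φ j) / (φ j : ℝ)) atTop
      (𝓝 (⨅ Q : PeriodicConfiguration 3, Q.energyPerParticle lennardJones)) :=
    hLim.comp hφ.tendsto_atTop
  have hEq := tendsto_nhds_unique hE hlim'
  exact frequently_laminarWindow_of_hcpLaw x hφ P htr (hPR δ hδ P hP hcore hmecke hEq.le) hη L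

/-! ## The crux BY NAME from the hcp programme's central statements -/

/-- **`PalmRigidity → LjLaminarWindows`.** The target-level statement of route PalmUnimodularRigidity (⇐ cruxes 9225 `MinimiserShells`
∧ 9226 `LayeredLawsSelectHcp`, glue landed) implies the crux of route ChessboardParticlePlanes, through S9♭ and the landed equivalence
`LjLaminarWindowsSketch.LjLaminarWindows_of_oneWindowAllScales` (p137588). Conditional result (door); nothing is claimed about
`PalmRigidity`. -/
theorem LjLaminarWindows_of_palmRigidity :
    PalmUnimodularRigidity.PalmRigidity → Summit.AtomisticToContinuum.Crystallization.Theses.ChessboardParticlePlanes.LjLaminarWindows :=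
  fun hPR =>
    Summit.AtomisticToContinuum.Crystallization.Theorems.LjLaminarWindowsSketch.LjLaminarWindows_of_oneWindowAllScales
      (oneWindowAllScales_of_palmRigidity hPR)

/-- **`ZeroDefectDensity → FunnelLawRigidity → LjLaminarWindows`.** Item 13604 (zero defect density along Lennard-Jones ground states)
and FUNNEL LAW RIGIDITY (⇐ crux 13603's CORE `stub_funnelDefectFloor`) imply the crux, through the landed P1 `PalmGoodLaw.stub_goodLaw`,
`oneWindowAllScales_of_funnelLawRigidity` and p137588. Conditional result (door). -/
theorem LjLaminarWindows_of_funnelLawRigidity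
    (hZ : Summit.AtomisticToContinuum.Crystallization.Theses.ReggeStarCoercivity.ZeroDefectDensity)
    (hFR : ∀ δ : ℝ, 0 < δ → ∀ P : Measure (Measure (EuclideanSpace ℝ (Fin 3))), IsProbabilityMeasure P →
      (∀ᵐ μ ∂P, IsRootedHardCore δ μ) → IsPointStationaryLaw P →
      (∫ μ, (∫ y, lennardJones ‖y‖ ∂μ) / 2 ∂P) ≤
        (⨅ Q : PeriodicConfiguration 3, Q.energyPerParticle lennardJones) →
      (∀ᵐ μ ∂P, ∃ S : Set (EuclideanSpace ℝ (Fin 3)),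
        μ = (Measure.count : Measure (EuclideanSpace ℝ (Fin 3))).restrict S ∧ ∀ y ∈ S, SetGood S y) →
      ∀ᵐ μ ∂P, ∃ a h : ℝ, ∃ ha : a ≠ 0, ∃ hh : h ≠ 0, 1 / 2 ≤ a ∧ a ≤ 2 ∧ 1 / 2 ≤ h ∧ h ≤ 2 ∧
        ∃ A : EuclideanSpace ℝ (Fin 3) ≃ₗᵢ[ℝ] EuclideanSpace ℝ (Fin 3),
          (hcpPeriodicConfiguration ha hh).energyPerParticle lennardJones =
            (⨅ Q : PeriodicConfiguration 3, Q.energyPerParticle lennardJones) ∧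
          μ = (Measure.count : Measure (EuclideanSpace ℝ (Fin 3))).restrict (A '' hcpStacking a h)) :
    Summit.AtomisticToContinuum.Crystallization.Theses.ChessboardParticlePlanes.LjLaminarWindows :=
  Summit.AtomisticToContinuum.Crystallization.Theorems.LjLaminarWindowsSketch.LjLaminarWindows_of_oneWindowAllScales
    (oneWindowAllScales_of_funnelLawRigidity PalmGoodLaw.stub_goodLaw hFR
      (fun x hx => (Summit.AtomisticToContinuum.Crystallization.Theorems.DefectFreeCrystallizes.Negative.PredicateAPI.zeroDefectDensity_iff.1
        hZ) x hx))

end Summit.AtomisticToContinuum.Crystallization.Theorems.StackingBlindBudgetFlatness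

end
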